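import Literature.Algebra.Homology.HyperExt
import Mathlib.Algebra.Homology.DerivedCategory.Ext.ExactSequences
import HarnessLib

/-!
# Hyper-Ext with values in a single complex `Y[-a]`: `HyperExt X Y[-a] n = Ext^{n-a}(X, Y)`

For an abelian category `C`, objects `X Y : C`, and the single cochain complex
`Y[-a] = (CochainComplex.singleFunctor C a).obj Y` (`Y` sitting in degree `a : ℤ`), the hyper-Ext
groups of `Literature.Algebra.Homology.HyperExt` (`HyperExt X K n = Hom_{D(C)}(X[0], K⟦n⟧)`, Weibel
Def. 10.7.1) are ordinary `Ext` groups with a SHIFT OF DEGREE: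

* `HyperExt.singleEquiv a m n h : HyperExt X Y[-a] n ≃+ Ext X Y m` for `a + m = n` — in `D(C)`,
  `Y[-a]⟦n⟧ ≅ Y[0]⟦m⟧` through the shift compatibility of the single functors
  (`DerivedCategory.singleFunctors`, `SingleFunctors.shiftIso`: `Y[-a]⟦a⟧ ≅ Y[0]`) and
  `shiftFunctorAdd'`; the case `a = 0` is the tree's `HyperExt.extEquiv` up to these canonical
  isomorphisms;
* naturality in `Y`: `singleEquiv_map` — under `singleEquiv`, `HyperExt.map (f[-a])` is
  postcomposition with `Ext.mk₀ f` (`Ext.comp · (mk₀ f)`);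
* `HyperExt.eq_zero_single_of_lt` — `HyperExt X Y[-a] n = 0` for `n < a`;
* transfers: `torsionFree_single_iff` (no `m`-torsion), `subsingleton_single_iff` (vanishing),
  `map_single_surjective_iff` / `map_single_injective_iff` (for a morphism `f : Y → Y'`, the map
  induced by `f[-a]` on `HyperExt` is onto / one-to-one iff `Ext(X, f)` is).

Why (where this is used): the long exact sequences of the STUPID FILTRATION of a complex `K`
(`Literature.Algebra.Homology.StupidFiltration(Degeneration)`: `0 → Kⁿ[-n] → σ≤n K → σ≤(n-1) K → 0`)
are phrased with `HyperExt A Kⁿ[-n] k`; every hypothesis on those terms (torsion-freeness,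
surjectivity of reduction maps, vanishing above the cohomological dimension) is in practice a
statement about `Ext^{k-n}(A, Kⁿ)` — for `A = ℤ` on a space, about sheaf cohomology
`H^{k-n}(X, Kⁿ)` (Mathlib's `Sheaf.H`, which IS `Ext` from the constant sheaf) — e.g. the
`p`-torsion-freeness of the Hodge cohomology `Hᵇ(𝒳, Ωʲ)` in the `p`-adic lifting argument of
Bloch–Esnault–Kerz (Invent. Math. 195 (2014), Rem. 35) / X. Hu (arXiv:2507.12458, §11). This file
is that dictionary. Everything is proved; no named facts. [folklore]

References: C. A. Weibel, *An introduction to homological algebra* (1994), Def. 10.7.1, 10.4;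
Mathlib `Mathlib.Algebra.Homology.DerivedCategory.Ext.Basic` (`Ext.homAddEquiv`),
`Mathlib.CategoryTheory.Shift.SingleFunctors`.
-/

universe w w' v u

open CategoryTheory Limits

namespace Literature.Algebra.Homology

namespace HyperExt

variable {C : Type u} [Category.{v} C] [Abelian C]

open DerivedCategory

/-! ### Postcomposition with an isomorphism, as an additive equivalence -/

/-- In a preadditive category, postcomposition with an isomorphism `β : B ≅ B'` is an additive
equivalence `(A ⟶ B) ≃+ (A ⟶ B')`. [folklore] -/
@[simps]
def postcompAddEquiv {D : Type*} [Category D] [Preadditive D] {A B B' : D} (β : B ≅ B') :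
    (A ⟶ B) ≃+ (A ⟶ B') where
  toFun f := f ≫ β.hom
  invFun g := g ≫ β.inv
  left_inv f := by simp
  right_inv g := by simp
  map_add' f g := Preadditive.add_comp _ _ _ _ _ _

/-! ### The shift isomorphism `Y[-a]⟦n⟧ ≅ Y[0]⟦m⟧` in the derived category -/

section ShiftIso

variable (C) [HasDerivedCategory.{w'} C]

/-- For `a + m = n`, the natural isomorphism of functors `C ⥤ D(C)`,
`Y ↦ (Y[-a]⟦n⟧ ≅ Y[-a]⟦a⟧⟦m⟧ ≅ Y[0]⟦m⟧)`: `shiftFunctorAdd'` followed by the shift compatibility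
`Y[-a]⟦a⟧ ≅ Y[0]` of the single functors of the derived category
(`(DerivedCategory.singleFunctors C).shiftIso a 0 a`). [folklore] -/
noncomputable def singleShiftNatIso (a m n : ℤ) (h : a + m = n) :
    singleFunctor C a ⋙ shiftFunctor (DerivedCategory C) n ≅
      singleFunctor C 0 ⋙ shiftFunctor (DerivedCategory C) m :=
  Functor.isoWhiskerLeft (singleFunctor C a) (shiftFunctorAdd' (DerivedCategory C) a m n h) ≪≫
    (Functor.associator _ _ _).symm ≪≫
    Functor.isoWhiskerRight ((singleFunctors C).shiftIso a 0 a (add_zero a)) (shiftFunctor _ m)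

variable {C}

/-- The components `Y[-a]⟦n⟧ ≅ Y[0]⟦m⟧` of `singleShiftNatIso`. [folklore] -/
noncomputable def singleShiftIso (a m n : ℤ) (h : a + m = n) (Y : C) :
    ((singleFunctor C a).obj Y)⟦n⟧ ≅ ((singleFunctor C 0).obj Y)⟦m⟧ :=
  (singleShiftNatIso C a m n h).app Y

/-- Naturality of `singleShiftIso` in `Y`. [folklore] -/
@[reassoc]
theorem singleShiftIso_hom_naturality (a m n : ℤ) (h : a + m = n) {Y Y' : C} (f : Y ⟶ Y') :
    ((singleFunctor C a).map f)⟦n⟧' ≫ (singleShiftIso a m n h Y').hom =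
      (singleShiftIso a m n h Y).hom ≫ ((singleFunctor C 0).map f)⟦m⟧' :=
  (singleShiftNatIso C a m n h).hom.naturality f

end ShiftIso

/-! ### `HyperExt X Y[-a] n ≃+ Ext X Y m` -/

section Single

variable [HasExt.{w} C] {X : C}

/-- **`HyperExt X Y[-a] n ≃+ Extᵐ(X, Y)` for `a + m = n`**: a morphism `X[0] ⟶ Y[-a]⟦n⟧` in the
(constructed) derived category is a morphism `X[0] ⟶ Y[0]⟦m⟧` through `Y[-a]⟦n⟧ ≅ Y[0]⟦m⟧`
(`singleShiftIso`), i.e. an element of Mathlib's `Abelian.Ext X Y m` (`Ext.homAddEquiv`).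
(Weibel Def. 10.7.1 with 10.4: `Hom_D(X, Y[m]) = Extᵐ(X, Y)`.) [cite: Weibel1994, Def. 10.7.1] -/
noncomputable def singleEquiv (Y : C) (a : ℤ) (m : ℕ) (n : ℤ) (h : a + m = n)
    [HasHyperExt.{w} X ((CochainComplex.singleFunctor C a).obj Y)] :
    HyperExt.{w} X ((CochainComplex.singleFunctor C a).obj Y) n ≃+ Abelian.Ext.{w} X Y m :=
  letI := HasDerivedCategory.standard C
  homAddEquiv.trans
    ((postcompAddEquiv (A := (singleFunctor C 0).obj X) (singleShiftIso a m n h Y)).trans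
      Abelian.Ext.homAddEquiv.symm)

/-- `singleEquiv` on the level of morphisms of the constructed derived category:
`(singleEquiv x).hom = hom x ≫ (Y[-a]⟦n⟧ ≅ Y[0]⟦m⟧)`. [folklore] -/
theorem hom_singleEquiv (Y : C) (a : ℤ) (m : ℕ) (n : ℤ) (h : a + m = n)
    [HasHyperExt.{w} X ((CochainComplex.singleFunctor C a).obj Y)]
    (x : HyperExt.{w} X ((CochainComplex.singleFunctor C a).obj Y) n) :
    letI := HasDerivedCategory.standard C
    (singleEquiv Y a m n h x).hom = homAddEquiv x ≫ (singleShiftIso a m n h Y).hom := by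
  letI := HasDerivedCategory.standard C
  change Abelian.Ext.homAddEquiv (Abelian.Ext.homAddEquiv.symm _) = _
  rw [AddEquiv.apply_symm_apply]
  rfl

/-- **Naturality of `singleEquiv` in `Y`**: for `f : Y ⟶ Y'`, the map induced on `HyperExt` by
`f[-a] : Y[-a] ⟶ Y'[-a]` corresponds to postcomposition with `Ext.mk₀ f` on `Ext`. [folklore] -/
theorem singleEquiv_map {Y Y' : C} (f : Y ⟶ Y') (a : ℤ) (m : ℕ) (n : ℤ) (h : a + m = n)
    [HasHyperExt.{w} X ((CochainComplex.singleFunctor C a).obj Y)]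
    [HasHyperExt.{w} X ((CochainComplex.singleFunctor C a).obj Y')]
    (x : HyperExt.{w} X ((CochainComplex.singleFunctor C a).obj Y) n) :
    singleEquiv Y' a m n h (map ((CochainComplex.singleFunctor C a).map f) n x) =
      (singleEquiv Y a m n h x).comp (Abelian.Ext.mk₀ f) (add_zero m) := by
  letI := HasDerivedCategory.standard C
  apply Abelian.Ext.homAddEquiv.injective
  change (singleEquiv Y' a m n h (map ((CochainComplex.singleFunctor C a).map f) n x)).hom =
    ((singleEquiv Y a m n h x).comp (Abelian.Ext.mk₀ f) (add_zero m)).hom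
  rw [hom_singleEquiv, homAddEquiv_map, ← Abelian.Ext.hom_comp_singleFunctor_map_shift,
    hom_singleEquiv, Category.assoc, Category.assoc]
  exact congrArg (homAddEquiv x ≫ ·) (singleShiftIso_hom_naturality a m n h f)

omit [HasExt.{w} C] in
/-- **Vanishing below the degree of the single complex**: `HyperExt X Y[-a] n = 0` for `n < a`
(`Y[-a]` is cohomologically in degrees `≥ a`). [folklore] -/
theorem eq_zero_single_of_lt (Y : C) (a n : ℤ) (hn : n < a)
    [HasHyperExt.{w} X ((CochainComplex.singleFunctor C a).obj Y)]
    (x : HyperExt.{w} X ((CochainComplex.singleFunctor C a).obj Y) n) : x = 0 :=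
  eq_zero_of_isGE a hn x

/-! ### Transfers along `singleEquiv` -/

variable (Y : C) (a : ℤ) (m : ℕ) (n : ℤ) (h : a + m = n)
  [HasHyperExt.{w} X ((CochainComplex.singleFunctor C a).obj Y)]

include h

/-- `HyperExt X Y[-a] n` has no `q`-torsion iff `Extᵐ(X, Y)` has none (`a + m = n`). [folklore] -/
theorem torsionFree_single_iff (q : ℤ) :
    (∀ x : HyperExt.{w} X ((CochainComplex.singleFunctor C a).obj Y) n, q • x = 0 → x = 0) ↔
      ∀ y : Abelian.Ext.{w} X Y m, q • y = 0 → y = 0 := by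
  constructor
  · intro hx y hy
    apply (singleEquiv Y a m n h).symm.injective
    rw [map_zero]
    exact hx _ (by rw [← map_zsmul, hy, map_zero])
  · intro hy x hx
    apply (singleEquiv Y a m n h).injective
    rw [map_zero]
    exact hy _ (by rw [← map_zsmul, hx, map_zero])

/-- `HyperExt X Y[-a] n` vanishes iff `Extᵐ(X, Y)` does (`a + m = n`). [folklore] -/
theorem subsingleton_single_iff :
    Subsingleton (HyperExt.{w} X ((CochainComplex.singleFunctor C a).obj Y) n) ↔
      Subsingleton (Abelian.Ext.{w} X Y m) :=
  ⟨fun _ => (singleEquiv Y a m n h).symm.injective.subsingleton,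
    fun _ => (singleEquiv Y a m n h).injective.subsingleton⟩

variable {Y} {Y' : C} (f : Y ⟶ Y') [HasHyperExt.{w} X ((CochainComplex.singleFunctor C a).obj Y')]

/-- The map induced by `f[-a]` on `HyperExt X ·[-a] n` is onto iff postcomposition with `Ext.mk₀ f`
on `Extᵐ(X, ·)` is (`a + m = n`). [folklore] -/
theorem map_single_surjective_iff :
    Function.Surjective (map (X := X) ((CochainComplex.singleFunctor C a).map f) n) ↔
      Function.Surjective fun y : Abelian.Ext.{w} X Y m => y.comp (Abelian.Ext.mk₀ f) (add_zero m) := by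
  have hsq : (fun y : Abelian.Ext.{w} X Y m => y.comp (Abelian.Ext.mk₀ f) (add_zero m)) ∘
      singleEquiv Y a m n h = singleEquiv Y' a m n h ∘
        map (X := X) ((CochainComplex.singleFunctor C a).map f) n :=
    funext fun x => (singleEquiv_map f a m n h x).symm
  constructor
  · intro hs
    have h' : Function.Surjective (singleEquiv Y' a m n h ∘
        map (X := X) ((CochainComplex.singleFunctor C a).map f) n) :=
      (singleEquiv Y' a m n h).surjective.comp hs
    rw [← hsq] at h'
    exact Function.Surjective.of_comp h'
  · intro hs
    have h' : Function.Surjective ((fun y : Abelian.Ext.{w} X Y m =>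
        y.comp (Abelian.Ext.mk₀ f) (add_zero m)) ∘ singleEquiv Y a m n h) :=
      hs.comp (singleEquiv Y a m n h).surjective
    rw [hsq] at h'
    exact (Function.Surjective.of_comp_iff' (singleEquiv Y' a m n h).bijective _).mp h'

/-- The map induced by `f[-a]` on `HyperExt X ·[-a] n` is one-to-one iff postcomposition with
`Ext.mk₀ f` on `Extᵐ(X, ·)` is (`a + m = n`). [folklore] -/
theorem map_single_injective_iff :
    Function.Injective (map (X := X) ((CochainComplex.singleFunctor C a).map f) n) ↔
      Function.Injective fun y : Abelian.Ext.{w} X Y m => y.comp (Abelian.Ext.mk₀ f) (add_zero m) := by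
  have hsq : (fun y : Abelian.Ext.{w} X Y m => y.comp (Abelian.Ext.mk₀ f) (add_zero m)) ∘
      singleEquiv Y a m n h = singleEquiv Y' a m n h ∘
        map (X := X) ((CochainComplex.singleFunctor C a).map f) n :=
    funext fun x => (singleEquiv_map f a m n h x).symm
  constructor
  · intro hi
    have h' : Function.Injective (singleEquiv Y' a m n h ∘
        map (X := X) ((CochainComplex.singleFunctor C a).map f) n) :=
      (singleEquiv Y' a m n h).injective.comp hi
    rw [← hsq] at h'
    exact (Function.Injective.of_comp_iff' _ (singleEquiv Y a m n h).bijective).mp h'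
  · intro hi
    have h' : Function.Injective ((fun y : Abelian.Ext.{w} X Y m =>
        y.comp (Abelian.Ext.mk₀ f) (add_zero m)) ∘ singleEquiv Y a m n h) :=
      hi.comp (singleEquiv Y a m n h).injective
    rw [hsq] at h'
    exact Function.Injective.of_comp h'

end Single

end HyperExt

end Literature.Algebra.Homology
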